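import Literature.AlgebraicGeometry.HodgeTheory.SerreTheoremALineBundles
import Literature.AlgebraicGeometry.HodgeTheory.BertiniPencilAnalytic
import Literature.AlgebraicGeometry.HodgeTheory.CartierTwistTower
import Literature.Geometry.Kaehler.HolomorphicLineBundleCechSkyscraper
import Literature.Geometry.Kaehler.HolomorphicLineBundleCechFiniteAll
import Literature.Geometry.Kaehler.HolomorphicLineBundleCechLerayData
import Literature.Geometry.Kaehler.HolomorphicLineBundleCechH0
import Literature.Geometry.Kaehler.HolomorphicInterpolation
import Literature.Geometry.Kaehler.TransversalPairDivision
import Literature.Algebra.Homology.NatCochainSixTerm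
import Literature.Algebra.Homology.NatCochainCokernelSequence
import HarnessLib

/-!
# Serre's théorème A for line cocycles on a smooth projective surface — the dimension count

Proof file for `Literature.AlgebraicGeometry.HodgeTheory.serre_theoremA_lineCocycle_surface`
(J.-P. Serre, *GAGA* (1956), n° 16 Lemme 8, for `𝓜 = 𝒪(L)` on a smooth projective surface),
organised as Serre's induction over two general hyperplane sections in its Euler-characteristic
(six-term) form `Literature.Algebra.Homology.exists_pos_h0_of_euler_inequalities`:

* the tower `L_m = L ⊗ 𝒪_X(mH)^an` (`CartierTwistTower`) on the level-`0` cover `𝔙` of nested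
  Leray data (ONE framed cover for all `m`), its Čech complexes `C•(𝔙, 𝒪(L_m))`
  (`HolomorphicLineBundleCech`) and the cochain maps "multiplication by `t = u₀`, `t' = u₁`"
  (`HolomorphicLineBundleCechTwist.mulCochain`) given by the coordinates of two algebraic sections
  `s₀ = 1`, `s₁` of `𝒪_X(H)` (`BertiniPencilAnalytic.exists_transverse_flag`: smooth transversal
  hyperplane sections, finite non-empty common zero set `Z`, dense non-vanishing loci);
* level `2`: `F₂(m) = C•(𝔙, 𝒪(L_{m+2}))` — `h⁰, h¹, h²` finite by the twisted Cartan–Serre theorem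
  in all degrees (`DolbeaultLerayDatum.finite_cohomologyL`);
* level `1`: `F₁(m) = Coker(t : C•(L_{m+1}) → C•(L_{m+2}))` (`NatCochain.Coker`, injective by
  density), linked by the maps induced by `t'`, injective by the regular-pair lemma on the
  chart-convex members (`TransversalPairChart`);
* level `0`: `F₀(m) =` the skyscraper complex `C•(𝔙, L_{m+2}|_Z)`
  (`HolomorphicLineBundleCechSkyscraper`): `h¹ = 0 < 1 ≤ h⁰`; the short exact sequences
  `0 → F₁(m) → F₁(m+1) → F₀(m+1) → 0` are built by hand (evaluation at `Z`, surjective by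
  interpolation, exact by the division property of a transversal pair);
* `h⁰(L_{m+2}) > 0` for some `m`, whence a section of `L ⊗ 𝒪_X((m+2)H)^an` not vanishing
  identically, with the algebraic section `1` of the effective divisor `(m+2)H`.

## References

* J.-P. Serre, *Géométrie algébrique et géométrie analytique*, Ann. Inst. Fourier 6 (1956), n° 16
  Lemme 8. [SerreGAGA1956]
* J.-P. Serre, *Faisceaux algébriques cohérents* (1955), n° 81. [SerreFAC1955]
-/

noncomputable section

open scoped Manifold ContDiff Topology
open CategoryTheory AlgebraicGeometry TopologicalSpace Set Function
open Literature.AlgebraicGeometry.Motives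
open Literature.AlgebraicGeometry.Motives.RatFn
open Literature.AlgebraicGeometry.Motives.AlgPoints
open Literature.NumberTheory.Transcendental
open Literature.Geometry.Kaehler
open Literature.Geometry.Kaehler.HolomorphicLineBundle
open Literature.Algebra.Homology

namespace Literature.AlgebraicGeometry.HodgeTheory

namespace SerreTheoremASurface

variable {X : SchemeOver ℂ} [IsIntegral X.left] {n : ℕ}
  {E : Type} [NormedAddCommGroup E] [NormedSpace ℂ E] [FiniteDimensional ℂ E]
  {M : Type} [TopologicalSpace M] [ChartedSpace E M]
  {φ : M → ComplexPoints X} (hφ : IsAnalytification E X n φ)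
  (H : CartierDivisor X.left) {ι : Type} (L : HolomorphicLineBundle ι E M)
  {s₀ s₁ : X.left.functionField} (hs₀ : H.IsSection s₀) (hs₁ : H.IsSection s₁)
  (D : DolbeaultLerayDatum E M) (fr : ↥D.s → ι × H.ι)
  (hfr : ∀ i, D.U 3 i ⊆ (twistBundle hφ H L 0).baseSet (fr i))

/-! ### The level-`0` cover of the Leray datum as a framed cover of every `L_m` -/

include hfr in
/-- The subordination of the Leray datum to `L_m` (the base sets do not depend on `m`). [folklore] -/
theorem hfr_twist (m : ℕ) : ∀ i, D.U 3 i ⊆ (twistBundle hφ H L m).baseSet (fr i) := hfr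

/-- **The cover `𝔙 = 𝔘₀` as a framed cover of `L_m`.** [cite: SerreGAGA1956, n°16 Lemme 8] -/
abbrev cov (m : ℕ) : (twistBundle hφ H L m).FramedCover ↥D.s :=
  D.framedCover fr (hfr_twist hφ H L D fr hfr m) 0

/-- The members of `𝔙` lie in the base sets of `L_{m'}` through the frames, for every `m'`. [folklore] -/
theorem cov_subset (m m' : ℕ) (k : ↥D.s) :
    (cov hφ H L D fr hfr m).U k ⊆ (twistBundle hφ H L m').baseSet ((cov hφ H L D fr hfr m).frame k) :=
  (D.mono 0 3 (Fin.zero_le _) k).trans (hfr k)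

/-! ### Multiplication by the two sections on cochains -/

/-- **Multiplication by `t = u₀` (the coordinates of `s₀`)**: `C^a(𝔙, 𝒪(L_m)) → C^a(𝔙, 𝒪(L_{m+1}))`.
[cite: SerreGAGA1956, n°16 Lemme 8 (proof)] -/
def mulT (m a : ℕ) : (cov hφ H L D fr hfr m).Cochain a →ₗ[ℂ] (cov hφ H L D fr hfr (m + 1)).Cochain a :=
  (cov hφ H L D fr hfr m).mulCochain (homSectionOfIsSection hφ H L hs₀ m) (cov_subset hφ H L D fr hfr m (m + 1)) a

/-- `mulT` is a cochain map. [cite: SerreFAC1955, n° 81] -/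
theorem mulT_comm (m a : ℕ) (c : (cov hφ H L D fr hfr m).Cochain a) :
    mulT hφ H L hs₀ D fr hfr m (a + 1) ((cov hφ H L D fr hfr m).delta a c) =
      (cov hφ H L D fr hfr (m + 1)).delta a (mulT hφ H L hs₀ D fr hfr m a c) :=
  ((cov hφ H L D fr hfr m).delta_mulCochain (homSectionOfIsSection hφ H L hs₀ m)
    (cov_subset hφ H L D fr hfr m (m + 1)) a c).symm

/-- `mulT` at a point of `V_J`. [folklore] -/
theorem mulT_apply_apply_of_mem (m : ℕ) {a : ℕ} (c : (cov hφ H L D fr hfr m).Cochain a)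
    {J : Fin (a + 1) → ↥D.s} {x : M} (hx : x ∈ cechSet (D.U 0) J) :
    (mulT hφ H L hs₀ D fr hfr m a c J : M → ℂ) x = H.sectionCoord φ hs₀ (fr (J 0)).2 x * (c J : M → ℂ) x :=
  (cov hφ H L D fr hfr m).mulCochain_apply_apply_of_mem _ _ c hx

/-- **`mulT` is injective** when `{u₀ ≠ 0}` is dense. [cite: SerreGAGA1956, n°7 Prop. 5] -/
theorem mulT_injective (hdense : Dense {x : M | ∀ a : H.ι, (φ x).pt ∈ H.U a → H.sectionCoord φ hs₀ a x ≠ 0})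
    (m a : ℕ) : Injective (mulT hφ H L hs₀ D fr hfr m a) :=
  (cov hφ H L D fr hfr m).mulCochain_injective _ _ fun J ↦
    cechSet_subset_closure_coord_ne_zero hφ H L hs₀ (cov hφ H L D fr hfr m) hdense J

/-- **The two multiplications commute**: `t' (t c) = t (t' c)`. [cite: SerreGAGA1956, n°16 Lemme 8 (proof)] -/
theorem mulT_mulT_comm (m a : ℕ) (c : (cov hφ H L D fr hfr m).Cochain a) :
    mulT hφ H L hs₁ D fr hfr (m + 1) a (mulT hφ H L hs₀ D fr hfr m a c) =
      mulT hφ H L hs₀ D fr hfr (m + 1) a (mulT hφ H L hs₁ D fr hfr m a c) :=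
  (cov hφ H L D fr hfr m).mulCochain_mulCochain_comm (homSectionOfIsSection hφ H L hs₀ m)
    (homSectionOfIsSection hφ H L hs₁ (m + 1)) (homSectionOfIsSection hφ H L hs₁ m)
    (homSectionOfIsSection hφ H L hs₀ (m + 1)) _ _ _ (fun _ _ _ ↦ mul_comm _ _) a c

/-! ### Level `1`: the cokernel complexes `Coker(t)` and the maps induced by `t'` -/

/-- **`F₁`: the cokernel complex `C•(𝔙, 𝒪(L_{m+1})) / t C•(𝔙, 𝒪(L_m))`** (the Čech complex of
the sheaf cokernel `𝓠` read without constructing it). [cite: SerreGAGA1956, n°16 Lemme 8 (proof)] -/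
abbrev Q (m a : ℕ) : Type := NatCochain.Coker (fun a ↦ mulT hφ H L hs₀ D fr hfr m a) a

/-- The differential of `F₁`. [folklore] -/
abbrev dQ (m : ℕ) (a : ℕ) : Q hφ H L hs₀ D fr hfr m a →ₗ[ℂ] Q hφ H L hs₀ D fr hfr m (a + 1) :=
  NatCochain.cokerD (fun a ↦ mulT hφ H L hs₀ D fr hfr m a) (mulT_comm hφ H L hs₀ D fr hfr m) a

/-- **The map `F₁(m) → F₁(m+1)` induced by `t'`** (`Coker.map` of the commuting square
`t' t = t t'`). [cite: SerreGAGA1956, n°16 Lemme 8 (proof)] -/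
def vQ (m a : ℕ) : Q hφ H L hs₀ D fr hfr m a →ₗ[ℂ] Q hφ H L hs₀ D fr hfr (m + 1) a :=
  NatCochain.Coker.map (f := fun a ↦ mulT hφ H L hs₀ D fr hfr m a) (f' := fun a ↦ mulT hφ H L hs₀ D fr hfr (m + 1) a)
    (fun a ↦ mulT hφ H L hs₁ D fr hfr m a) (fun a ↦ mulT hφ H L hs₁ D fr hfr (m + 1) a)
    (fun a c ↦ mulT_mulT_comm hφ H L hs₀ hs₁ D fr hfr m a c) a

/-- `vQ` is a cochain map. [folklore] -/
theorem vQ_comm (m a : ℕ) (c : Q hφ H L hs₀ D fr hfr m a) :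
    vQ hφ H L hs₀ hs₁ D fr hfr m (a + 1) (dQ hφ H L hs₀ D fr hfr m a c) =
      dQ hφ H L hs₀ D fr hfr (m + 1) a (vQ hφ H L hs₀ hs₁ D fr hfr m a c) :=
  NatCochain.Coker.map_comm _ _ _ _ _ (fun a c ↦ mulT_comm hφ H L hs₁ D fr hfr _ a c) a c

/-! ### The common zero set `Z` of the two sections -/

/-- **`Z = {s₀ = s₁ = 0}` read on `M`**: the points at which both section coordinates vanish in some
(equivalently every, `mem_zset_iff`) frame. [cite: SerreGAGA1956, n°16 Lemme 8 (proof)] -/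
def zset : Set M :=
  {x | ∃ a : H.ι, (φ x).pt ∈ H.U a ∧ H.sectionCoord φ hs₀ a x = 0 ∧ H.sectionCoord φ hs₁ a x = 0}

omit [TopologicalSpace M] in
/-- The vanishing of a section coordinate does not depend on the frame (`s_b = g_{ba} s_a` with
`g_{ba}(x) ≠ 0`). [cite: GortzWedhorn2020, Rem. 11.16 (p. 369)] -/
theorem sectionCoord_eq_zero_iff {s : X.left.functionField} (hs : H.IsSection s) {a b : H.ι} {x : M}
    (ha : (φ x).pt ∈ H.U a) (hb : (φ x).pt ∈ H.U b) :
    H.sectionCoord φ hs a x = 0 ↔ H.sectionCoord φ hs b x = 0 := by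
  have key : ∀ {i j : H.ι}, (φ x).pt ∈ H.U i → (φ x).pt ∈ H.U j →
      H.sectionCoord φ hs i x = 0 → H.sectionCoord φ hs j x = 0 := fun hi hj h0 ↦ by
    rw [sectionCoord_eq_mul hs hi hj, h0, mul_zero]
  exact ⟨key ha hb, key hb ha⟩

omit [TopologicalSpace M] in
/-- Membership in `Z` read in any frame at hand. [folklore] -/
theorem mem_zset_iff {p : H.ι} {x : M} (hp : (φ x).pt ∈ H.U p) :
    x ∈ zset (φ := φ) H hs₀ hs₁ ↔ H.sectionCoord φ hs₀ p x = 0 ∧ H.sectionCoord φ hs₁ p x = 0 := by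
  constructor
  · rintro ⟨a, ha, h0, h1⟩
    exact ⟨(sectionCoord_eq_zero_iff H hs₀ ha hp).1 h0, (sectionCoord_eq_zero_iff H hs₁ ha hp).1 h1⟩
  · rintro ⟨h0, h1⟩
    exact ⟨p, hp, h0, h1⟩

include hφ L hfr in
/-- A point of `V_J` lies over `U_{(fr J₀).2}`. [folklore] -/
theorem pt_mem_of_mem_cechSet {a : ℕ} {J : Fin (a + 1) → ↥D.s} {x : M} (hx : x ∈ cechSet (D.U 0) J) :
    (φ x).pt ∈ H.U (fr (J 0)).2 :=
  (cov_subset hφ H L D fr hfr 0 0 (J 0) (mem_cechSet_iff.1 hx 0)).2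

include hφ L hfr in
/-- On `Z ∩ V_J` the coordinate `u₀` in the frame of `J 0` vanishes. [folklore] -/
theorem sectionCoord_fst_eq_zero {a : ℕ} {J : Fin (a + 1) → ↥D.s} {x : M} (hx : x ∈ cechSet (D.U 0) J)
    (hz : x ∈ zset (φ := φ) H hs₀ hs₁) : H.sectionCoord φ hs₀ (fr (J 0)).2 x = 0 :=
  ((mem_zset_iff H hs₀ hs₁ (pt_mem_of_mem_cechSet hφ H L D fr hfr hx)).1 hz).1

include hφ L hfr in
/-- On `Z ∩ V_J` the coordinate `u₁` in the frame of `J 0` vanishes. [folklore] -/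
theorem sectionCoord_snd_eq_zero {a : ℕ} {J : Fin (a + 1) → ↥D.s} {x : M} (hx : x ∈ cechSet (D.U 0) J)
    (hz : x ∈ zset (φ := φ) H hs₀ hs₁) : H.sectionCoord φ hs₁ (fr (J 0)).2 x = 0 :=
  ((mem_zset_iff H hs₀ hs₁ (pt_mem_of_mem_cechSet hφ H L D fr hfr hx)).1 hz).2

/-! ### Level `0`: the skyscraper complexes and evaluation at `Z` -/

/-- **`F₀`: the skyscraper complex `C•(𝔙, L_m|_Z)`.** [cite: SerreFAC1955, n° 81] -/
abbrev S (m a : ℕ) : Type := (cov hφ H L D fr hfr m).ZCochain (zset (φ := φ) H hs₀ hs₁) a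

/-- The differential of `F₀`. [folklore] -/
abbrev dS (m a : ℕ) : S hφ H L hs₀ hs₁ D fr hfr m a →ₗ[ℂ] S hφ H L hs₀ hs₁ D fr hfr m (a + 1) :=
  (cov hφ H L D fr hfr m).zdelta (zset (φ := φ) H hs₀ hs₁) a

/-- Restriction to `Z` kills the `t`-multiples (`t = u₀` vanishes on `Z`). [cite: SerreGAGA1956, n°16 Lemme 8 (proof)] -/
theorem toZ_mulT (m a : ℕ) (c : (cov hφ H L D fr hfr m).Cochain a) :
    (cov hφ H L D fr hfr (m + 1)).toZ (zset (φ := φ) H hs₀ hs₁) a (mulT hφ H L hs₀ D fr hfr m a c) = 0 := by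
  refine funext fun J ↦ Subtype.ext (funext fun x ↦ ?_)
  by_cases hx : x ∈ zset (φ := φ) H hs₀ hs₁ ∩ cechSet (D.U 0) J
  · rw [FramedCover.toZ_apply_apply_of_mem _ _ _ hx, mulT_apply_apply_of_mem hφ H L hs₀ D fr hfr m c hx.2,
      sectionCoord_fst_eq_zero hφ H L hs₀ hs₁ D fr hfr hx.2 hx.1, zero_mul]
    rfl
  · rw [FramedCover.toZ_apply_apply_of_notMem _ _ _ hx]
    rfl

/-- **Evaluation at `Z`: `F₁(m) = Coker(t) → F₀`, `[b] ↦ b|_Z`** (well defined by `toZ_mulT`).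
[cite: SerreGAGA1956, n°16 Lemme 8 (proof)] -/
def evalQ (m a : ℕ) : Q hφ H L hs₀ D fr hfr m a →ₗ[ℂ] S hφ H L hs₀ hs₁ D fr hfr (m + 1) a :=
  (LinearMap.range (mulT hφ H L hs₀ D fr hfr m a)).liftQ
    ((cov hφ H L D fr hfr (m + 1)).toZ (zset (φ := φ) H hs₀ hs₁) a) (by
      rintro _ ⟨c, rfl⟩
      exact toZ_mulT hφ H L hs₀ hs₁ D fr hfr m a c)

/-- `evalQ` on a class. [folklore] -/
theorem evalQ_mk (m a : ℕ) (b : (cov hφ H L D fr hfr (m + 1)).Cochain a) :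
    evalQ hφ H L hs₀ hs₁ D fr hfr m a (Submodule.Quotient.mk b) =
      (cov hφ H L D fr hfr (m + 1)).toZ (zset (φ := φ) H hs₀ hs₁) a b :=
  rfl

/-- `evalQ` is a cochain map. [cite: SerreFAC1955, n° 81] -/
theorem evalQ_comm (m a : ℕ) (q : Q hφ H L hs₀ D fr hfr m a) :
    evalQ hφ H L hs₀ hs₁ D fr hfr m (a + 1) (dQ hφ H L hs₀ D fr hfr m a q) =
      dS hφ H L hs₀ hs₁ D fr hfr (m + 1) a (evalQ hφ H L hs₀ hs₁ D fr hfr m a q) := by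
  obtain ⟨b, rfl⟩ := Submodule.Quotient.mk_surjective _ q
  rw [NatCochain.cokerD_mk, evalQ_mk, evalQ_mk, FramedCover.toZ_delta]

/-- A holomorphic function on `W`, cut off by zero outside, as an element of `𝒪(W)`. [folklore] -/
def holCut {W : Set M} (f : M → ℂ) (hf : MDifferentiableOn 𝓘(ℂ, E) 𝓘(ℂ, ℂ) f W) : holFunOn E W :=
  ⟨W.indicator f, hf.congr fun _ hx ↦ indicator_of_mem hx _, fun _ hx ↦ indicator_of_notMem hx _⟩

omit [FiniteDimensional ℂ E] in
/-- `holCut` on `W`. [folklore] -/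
theorem holCut_apply_of_mem {W : Set M} (f : M → ℂ) (hf : MDifferentiableOn 𝓘(ℂ, E) 𝓘(ℂ, ℂ) f W)
    {x : M} (hx : x ∈ W) : (holCut f hf : M → ℂ) x = f x :=
  indicator_of_mem hx _

variable [IsManifold 𝓘(ℂ, E) ω M]

/-- **Evaluation at the finite set `Z` is surjective** (interpolation on the chart-convex members
`V_J`, `HolomorphicInterpolation`). [cite: SerreGAGA1956, n°16 Lemme 8 (proof)] -/
theorem evalQ_surjective (hZ : (zset (φ := φ) H hs₀ hs₁).Finite) (m a : ℕ) :
    Surjective (evalQ hφ H L hs₀ hs₁ D fr hfr m a) := by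
  classical
  intro w
  have key : ∀ J : Fin (a + 1) → ↥D.s, ∃ b : holFunOn E (cechSet (D.U 0) J),
      ∀ x ∈ zset (φ := φ) H hs₀ hs₁ ∩ cechSet (D.U 0) J, (b : M → ℂ) x = (w J : M → ℂ) x := by
    intro J
    set F := (hZ.inter_of_left (cechSet (D.U 0) J)).toFinset with hF
    have hFW : ∀ z ∈ F, z ∈ chartSet 𝓘(ℝ, E) (D.ctr a J) (D.C a J 0) := fun z hz ↦ by
      rw [← D.cechSet_eq a J 0]
      exact ((Set.Finite.mem_toFinset _).1 hz).2
    obtain ⟨f, hf, hfv⟩ := exists_mdifferentiableOn_chartSet_forall_eq (D.ctr a J) F hFW (w J : M → ℂ)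
    rw [← D.cechSet_eq a J 0] at hf
    exact ⟨holCut f hf, fun x hx ↦ (holCut_apply_of_mem f hf hx.2).trans
      (hfv x ((Set.Finite.mem_toFinset _).2 hx))⟩
  choose b hb using key
  refine ⟨Submodule.Quotient.mk b, ?_⟩
  rw [evalQ_mk]
  refine funext fun J ↦ Subtype.ext (funext fun x ↦ ?_)
  by_cases hx : x ∈ zset (φ := φ) H hs₀ hs₁ ∩ cechSet (D.U 0) J
  · rw [FramedCover.toZ_apply_apply_of_mem _ _ _ hx]
    exact hb J x hx
  · rw [FramedCover.toZ_apply_apply_of_notMem _ _ _ hx]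
    exact ((w J).2 x hx).symm

omit [IsManifold 𝓘(ℂ, E) ω M] in
/-- `evalQ ∘ vQ = 0`: `t' = u₁` vanishes on `Z`. [cite: SerreGAGA1956, n°16 Lemme 8 (proof)] -/
theorem evalQ_vQ (m a : ℕ) (q : Q hφ H L hs₀ D fr hfr m a) :
    evalQ hφ H L hs₀ hs₁ D fr hfr (m + 1) a (vQ hφ H L hs₀ hs₁ D fr hfr m a q) = 0 := by
  obtain ⟨b, rfl⟩ := Submodule.Quotient.mk_surjective _ q
  rw [vQ, NatCochain.Coker.map_mk, evalQ_mk]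
  refine funext fun J ↦ Subtype.ext (funext fun x ↦ ?_)
  by_cases hx : x ∈ zset (φ := φ) H hs₀ hs₁ ∩ cechSet (D.U 0) J
  · rw [FramedCover.toZ_apply_apply_of_mem _ _ _ hx, mulT_apply_apply_of_mem hφ H L hs₁ D fr hfr _ b hx.2,
      sectionCoord_snd_eq_zero hφ H L hs₀ hs₁ D fr hfr hx.2 hx.1, zero_mul]
    rfl
  · rw [FramedCover.toZ_apply_apply_of_notMem _ _ _ hx]
    rfl

/-! ### The regular-pair and division hypotheses on the members, and the short exact sequences -/

/-- **`vQ` is injective**: `t' b = t c` on `V_J` forces `t ∣ b` there (the regular-pair lemma on the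
chart-convex member `V_J`, `exists_mdifferentiableOn_eq_mul_of_mul_eq_mul_chartSet`).
[cite: SerreGAGA1956, n°16 Lemme 8 (proof)] [cite: Chirka1989, §2.8] -/
theorem vQ_injective
    (hd : ∀ (a : H.ι) (x : M), (φ x).pt ∈ H.U a → H.sectionCoord φ hs₀ a x = 0 →
      mfderiv 𝓘(ℂ, E) 𝓘(ℂ, ℂ) (H.sectionCoord φ hs₀ a) x ≠ 0)
    (htr : ∀ (a : H.ι) (x : M), (φ x).pt ∈ H.U a → H.sectionCoord φ hs₀ a x = 0 →
      H.sectionCoord φ hs₁ a x = 0 → ∀ c : ℂ,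
        mfderiv 𝓘(ℂ, E) 𝓘(ℂ, ℂ) (H.sectionCoord φ hs₁ a) x ≠ c • mfderiv 𝓘(ℂ, E) 𝓘(ℂ, ℂ) (H.sectionCoord φ hs₀ a) x)
    (m a : ℕ) : Injective (vQ hφ H L hs₀ hs₁ D fr hfr m a) := by
  refine NatCochain.Coker.injective_map _ _ _ a fun b hb ↦ ?_
  obtain ⟨c, hc⟩ := hb
  -- componentwise division on `V_J`
  have key : ∀ J : Fin (a + 1) → ↥D.s, ∃ h : holFunOn E (cechSet (D.U 0) J), ∀ x ∈ cechSet (D.U 0) J,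
      (b J : M → ℂ) x = H.sectionCoord φ hs₀ (fr (J 0)).2 x * (h : M → ℂ) x := by
    intro J
    set p := fr (J 0)
    have hWU : cechSet (D.U 0) J ⊆ φ ⁻¹' {P | P.pt ∈ H.U p.2} := fun x hx ↦
      pt_mem_of_mem_cechSet hφ H L D fr hfr hx
    have ht₀ : MDifferentiableOn 𝓘(ℂ, E) 𝓘(ℂ, ℂ) (H.sectionCoord φ hs₀ p.2) (cechSet (D.U 0) J) :=
      (mdifferentiableOn_sectionCoord hφ hs₀ p.2).mono hWU
    have ht₁ : MDifferentiableOn 𝓘(ℂ, E) 𝓘(ℂ, ℂ) (H.sectionCoord φ hs₁ p.2) (cechSet (D.U 0) J) :=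
      (mdifferentiableOn_sectionCoord hφ hs₁ p.2).mono hWU
    have heq : ∀ x ∈ cechSet (D.U 0) J, H.sectionCoord φ hs₁ p.2 x * (b J : M → ℂ) x =
        H.sectionCoord φ hs₀ p.2 x * (c J : M → ℂ) x := fun x hx ↦ by
      have h1 := congrArg (fun f : (cov hφ H L D fr hfr (m + 2)).Cochain a ↦ (f J : M → ℂ) x) hc
      simp only at h1
      rw [mulT_apply_apply_of_mem hφ H L hs₀ D fr hfr _ c hx] at h1
      rw [h1, mulT_apply_apply_of_mem hφ H L hs₁ D fr hfr _ b hx]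
    rw [D.cechSet_eq a J 0] at ht₀ ht₁
    obtain ⟨h, hh, hbh⟩ := exists_mdifferentiableOn_eq_mul_of_mul_eq_mul_chartSet (D.ctr a J) (D.C_open a J 0)
      (D.C_subset a J 0) ht₀ ht₁ (by rw [← D.cechSet_eq a J 0]; exact (b J).2.1)
      (fun x hx h0 ↦ hd p.2 x (hWU (by rwa [D.cechSet_eq a J 0])) h0)
      (fun x hx h0 h1 ↦ htr p.2 x (hWU (by rwa [D.cechSet_eq a J 0])) h0 h1)
      (fun x hx ↦ heq x (by rwa [D.cechSet_eq a J 0]))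
    rw [← D.cechSet_eq a J 0] at hh hbh
    exact ⟨holCut h hh, fun x hx ↦ by rw [holCut_apply_of_mem h hh hx]; exact hbh x hx⟩
  choose h hh using key
  refine ⟨h, funext fun J ↦ Subtype.ext (funext fun x ↦ ?_)⟩
  by_cases hx : x ∈ cechSet (D.U 0) J
  · rw [mulT_apply_apply_of_mem hφ H L hs₀ D fr hfr m h hx]
    exact (hh J x hx).symm
  · rw [holFunOn.apply_of_notMem _ hx, holFunOn.apply_of_notMem _ hx]

omit [IsManifold 𝓘(ℂ, E) ω M] in
/-- **Exactness of `F₁(m) → F₁(m+1) → F₀(m+1)` in the middle**, granted the division property of the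
transversal pair on the members: a class `[b]` with `b|_Z = 0` has `b_J = t a_J + t' b'_J`, so
`[b] = t' [b']`. [cite: SerreGAGA1956, n°16 Lemme 8 (proof)] -/
theorem exact_vQ_evalQ
    (hDv : ∀ (a : ℕ) (J : Fin (a + 1) → ↥D.s) (b : holFunOn E (cechSet (D.U 0) J)),
      (∀ x ∈ zset (φ := φ) H hs₀ hs₁ ∩ cechSet (D.U 0) J, (b : M → ℂ) x = 0) →
        ∃ b₀ b₁ : holFunOn E (cechSet (D.U 0) J), ∀ x ∈ cechSet (D.U 0) J,
          (b : M → ℂ) x = H.sectionCoord φ hs₀ (fr (J 0)).2 x * (b₀ : M → ℂ) x +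
            H.sectionCoord φ hs₁ (fr (J 0)).2 x * (b₁ : M → ℂ) x)
    (m a : ℕ) : Exact (vQ hφ H L hs₀ hs₁ D fr hfr m a) (evalQ hφ H L hs₀ hs₁ D fr hfr (m + 1) a) := by
  refine LinearMap.exact_iff.2 (le_antisymm ?_ ?_)
  · intro q hq
    obtain ⟨b, rfl⟩ := Submodule.Quotient.mk_surjective _ q
    rw [LinearMap.mem_ker, evalQ_mk] at hq
    have key : ∀ J : Fin (a + 1) → ↥D.s, ∃ b₀ b₁ : holFunOn E (cechSet (D.U 0) J), ∀ x ∈ cechSet (D.U 0) J,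
        (b J : M → ℂ) x = H.sectionCoord φ hs₀ (fr (J 0)).2 x * (b₀ : M → ℂ) x +
          H.sectionCoord φ hs₁ (fr (J 0)).2 x * (b₁ : M → ℂ) x := fun J ↦
      hDv a J (b J) fun x hx ↦ by
        have h1 := congrArg (fun f : (cov hφ H L D fr hfr (m + 2)).ZCochain (zset (φ := φ) H hs₀ hs₁) a ↦
          (f J : M → ℂ) x) hq
        simp only [Pi.zero_apply, ZeroMemClass.coe_zero] at h1
        rwa [FramedCover.toZ_apply_apply_of_mem _ _ _ hx] at h1
    choose b₀ b₁ hb using key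
    rw [vQ, NatCochain.Coker.mk_mem_range_map_iff]
    refine Submodule.mem_sup.2 ⟨mulT hφ H L hs₁ D fr hfr (m + 1) a b₁, ⟨b₁, rfl⟩,
      mulT hφ H L hs₀ D fr hfr (m + 1) a b₀, ⟨b₀, rfl⟩, ?_⟩
    refine funext fun J ↦ Subtype.ext (funext fun x ↦ ?_)
    by_cases hx : x ∈ cechSet (D.U 0) J
    · rw [Pi.add_apply, Submodule.coe_add, Pi.add_apply, mulT_apply_apply_of_mem hφ H L hs₁ D fr hfr _ b₁ hx,
        mulT_apply_apply_of_mem hφ H L hs₀ D fr hfr _ b₀ hx, hb J x hx]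
      ring
    · rw [holFunOn.apply_of_notMem _ hx, holFunOn.apply_of_notMem _ hx]
  · rintro _ ⟨q, rfl⟩
    exact evalQ_vQ hφ H L hs₀ hs₁ D fr hfr m a q

/-- **The short exact sequence `0 → F₁(m) → F₁(m+1) → F₀(m+2)' → 0`** of the bottom step
(`F₀` the skyscraper complex of `L_{m+2}` at `Z`). [cite: SerreGAGA1956, n°16 Lemme 8 (proof)] -/
def sesQ
    (hd : ∀ (a : H.ι) (x : M), (φ x).pt ∈ H.U a → H.sectionCoord φ hs₀ a x = 0 →
      mfderiv 𝓘(ℂ, E) 𝓘(ℂ, ℂ) (H.sectionCoord φ hs₀ a) x ≠ 0)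
    (htr : ∀ (a : H.ι) (x : M), (φ x).pt ∈ H.U a → H.sectionCoord φ hs₀ a x = 0 →
      H.sectionCoord φ hs₁ a x = 0 → ∀ c : ℂ,
        mfderiv 𝓘(ℂ, E) 𝓘(ℂ, ℂ) (H.sectionCoord φ hs₁ a) x ≠ c • mfderiv 𝓘(ℂ, E) 𝓘(ℂ, ℂ) (H.sectionCoord φ hs₀ a) x)
    (hDv : ∀ (a : ℕ) (J : Fin (a + 1) → ↥D.s) (b : holFunOn E (cechSet (D.U 0) J)),
      (∀ x ∈ zset (φ := φ) H hs₀ hs₁ ∩ cechSet (D.U 0) J, (b : M → ℂ) x = 0) →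
        ∃ b₀ b₁ : holFunOn E (cechSet (D.U 0) J), ∀ x ∈ cechSet (D.U 0) J,
          (b : M → ℂ) x = H.sectionCoord φ hs₀ (fr (J 0)).2 x * (b₀ : M → ℂ) x +
            H.sectionCoord φ hs₁ (fr (J 0)).2 x * (b₁ : M → ℂ) x)
    (hZ : (zset (φ := φ) H hs₀ hs₁).Finite) (m : ℕ) :
    NatCochain.ShortExactSeq (dQ hφ H L hs₀ D fr hfr m) (dQ hφ H L hs₀ D fr hfr (m + 1))
      (dS hφ H L hs₀ hs₁ D fr hfr (m + 2)) where
  f := vQ hφ H L hs₀ hs₁ D fr hfr m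
  g := evalQ hφ H L hs₀ hs₁ D fr hfr (m + 1)
  comm_f := vQ_comm hφ H L hs₀ hs₁ D fr hfr m
  comm_g := evalQ_comm hφ H L hs₀ hs₁ D fr hfr (m + 1)
  injective_f := vQ_injective hφ H L hs₀ hs₁ D fr hfr hd htr m
  exact_fg := exact_vQ_evalQ hφ H L hs₀ hs₁ D fr hfr hDv m
  surjective_g := evalQ_surjective hφ H L hs₀ hs₁ D fr hfr hZ (m + 1)
  dB_dB := NatCochain.cokerD_cokerD _ _ (fun a c ↦ (cov hφ H L D fr hfr (m + 2)).delta_delta a c)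

/-- **The short exact sequence `0 → C•(L_m) → C•(L_{m+1}) → Coker → 0`** of the top step.
[cite: SerreGAGA1956, n°16 Lemme 8 (proof)] -/
def sesC (hdense : Dense {x : M | ∀ a : H.ι, (φ x).pt ∈ H.U a → H.sectionCoord φ hs₀ a x ≠ 0}) (m : ℕ) :
    NatCochain.ShortExactSeq (fun a ↦ (cov hφ H L D fr hfr m).delta a) (fun a ↦ (cov hφ H L D fr hfr (m + 1)).delta a)
      (dQ hφ H L hs₀ D fr hfr m) :=
  NatCochain.cokerSeq (fun a ↦ mulT hφ H L hs₀ D fr hfr m a) (mulT_comm hφ H L hs₀ D fr hfr m)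
    (mulT_injective hφ H L hs₀ D fr hfr hdense m) (fun a c ↦ (cov hφ H L D fr hfr (m + 1)).delta_delta a c)

/-! ### Finiteness of `h⁰, h¹` at the three levels -/

/-- In an exact `P → Q → R` of vector spaces with `P, R` finite-dimensional, `Q` is finite-dimensional
(Mathlib `Module.Finite.of_exact` with `Q ↠ range`). [folklore] -/
theorem finiteDimensional_of_exact {P Q R : Type*} [AddCommGroup P] [Module ℂ P] [AddCommGroup Q]
    [Module ℂ Q] [AddCommGroup R] [Module ℂ R] {u : P →ₗ[ℂ] Q} {v : Q →ₗ[ℂ] R} (huv : Exact u v)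
    [FiniteDimensional ℂ P] [FiniteDimensional ℂ R] : FiniteDimensional ℂ Q :=
  Module.Finite.of_exact (f := u) (g := v.rangeRestrict)
    (fun y ↦ (show v.rangeRestrict y = 0 ↔ v y = 0 from
      ⟨fun h ↦ congrArg Subtype.val h, fun h ↦ Subtype.ext h⟩).trans (huv y))
    (LinearMap.surjective_rangeRestrict v)

variable [T2Space M] [CompactSpace M] [IsManifold 𝓘(ℝ, E) ∞ M]

/-- **`h^q(𝔙, 𝒪(L_m)) < ∞` for all `q`** (twisted Cartan–Serre in all degrees,
`DolbeaultLerayDatum.finiteDimensional_cohomologyL`). [cite: CartanSerre1953] -/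
theorem finiteDimensional_cohC (m q : ℕ) :
    FiniteDimensional ℂ (NatCochain.Cohomology (R := ℂ) (fun a ↦ (cov hφ H L D fr hfr m).delta a) q) :=
  D.finiteDimensional_cohomologyL fr (hfr_twist hφ H L D fr hfr m) q

/-- **`h^q(F₁(m)) < ∞`**: from `H^q(C•(L_{m+1})) → H^q(Coker) → H^{q+1}(C•(L_m))` (this is where
`h² < ∞` enters, for `q = 1`). [cite: SerreGAGA1956, n°16 Lemme 8 (proof)] -/
theorem finiteDimensional_cohQ
    (hdense : Dense {x : M | ∀ a : H.ι, (φ x).pt ∈ H.U a → H.sectionCoord φ hs₀ a x ≠ 0}) (m q : ℕ) :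
    FiniteDimensional ℂ (NatCochain.Cohomology (R := ℂ) (dQ hφ H L hs₀ D fr hfr m) q) := by
  haveI := finiteDimensional_cohC hφ H L D fr hfr (m + 1) q
  haveI := finiteDimensional_cohC hφ H L D fr hfr m (q + 1)
  exact finiteDimensional_of_exact ((sesC hφ H L hs₀ D fr hfr hdense m).exact_map_delta q)

omit [IsManifold 𝓘(ℂ, E) ω M] [T2Space M] [CompactSpace M] [IsManifold 𝓘(ℝ, E) ∞ M] in
/-- **`h^q(F₀) < ∞`** (finite `Z`, finitely many members). [cite: SerreFAC1955, n° 81] -/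
theorem finiteDimensional_cohS (hZ : (zset (φ := φ) H hs₀ hs₁).Finite) (m q : ℕ) :
    FiniteDimensional ℂ (NatCochain.Cohomology (R := ℂ) (dS hφ H L hs₀ hs₁ D fr hfr m) q) :=
  (cov hφ H L D fr hfr m).finiteDimensional_zcohomology (zset (φ := φ) H hs₀ hs₁) hZ q

omit [IsManifold 𝓘(ℂ, E) ω M] [T2Space M] [CompactSpace M] [IsManifold 𝓘(ℝ, E) ∞ M] in
/-- **The base of the count: `h¹(F₀) = 0 < 1 ≤ h⁰(F₀)`** (`Z ≠ ∅` meets the covering `𝔙`).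
[cite: SerreGAGA1956, n°16 Lemme 8 (dimension count)] -/
theorem finrank_cohS_one_lt (hZ : (zset (φ := φ) H hs₀ hs₁).Finite) (hZne : (zset (φ := φ) H hs₀ hs₁).Nonempty)
    (m : ℕ) :
    Module.finrank ℂ (NatCochain.Cohomology (R := ℂ) (dS hφ H L hs₀ hs₁ D fr hfr m) 1) <
      Module.finrank ℂ (NatCochain.Cohomology (R := ℂ) (dS hφ H L hs₀ hs₁ D fr hfr m) 0) := by
  obtain ⟨z₀, hz₀⟩ := hZne
  obtain ⟨k₀, hk₀⟩ : ∃ k, z₀ ∈ D.U 0 k := mem_iUnion.1 (by rw [D.cover 0]; exact mem_univ z₀)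
  haveI : Nonempty ↥D.s := ⟨k₀⟩
  haveI : Subsingleton (NatCochain.Cohomology (R := ℂ) (dS hφ H L hs₀ hs₁ D fr hfr m) 1) :=
    (cov hφ H L D fr hfr m).subsingleton_zcohomology_succ (zset (φ := φ) H hs₀ hs₁) 0
  haveI : Nontrivial (NatCochain.Cohomology (R := ℂ) (dS hφ H L hs₀ hs₁ D fr hfr m) 0) :=
    (cov hφ H L D fr hfr m).nontrivial_zcohomology_zero hz₀ hk₀
  haveI := finiteDimensional_cohS hφ H L hs₀ hs₁ D fr hfr hZ m 0
  have h0 : Module.finrank ℂ (NatCochain.Cohomology (R := ℂ) (dS hφ H L hs₀ hs₁ D fr hfr m) 1) = 0 :=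
    Module.finrank_zero_of_subsingleton
  rw [h0]
  exact Module.finrank_pos

/-! ### The dimension count -/

/-- The table `h^q(F_j(m))` fed to `exists_pos_h0_of_euler_inequalities`:
`F₂(m) = C•(L_{m+2})`, `F₁(m) = Coker(t : C•(L_{m+1}) → C•(L_{m+2}))`, `F₀(m) = C•(𝔙, L_{m+2}|_Z)`.
[cite: SerreGAGA1956, n°16 Lemme 8 (dimension count)] -/
def hnum (q : ℕ) : ℕ → ℕ → ℕ
  | 0, m => Module.finrank ℂ (NatCochain.Cohomology (R := ℂ) (dS hφ H L hs₀ hs₁ D fr hfr (m + 2)) q)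
  | 1, m => Module.finrank ℂ (NatCochain.Cohomology (R := ℂ) (dQ hφ H L hs₀ D fr hfr (m + 1)) q)
  | _ + 2, m => Module.finrank ℂ (NatCochain.Cohomology (R := ℂ) (fun a ↦ (cov hφ H L D fr hfr (m + 2)).delta a) q)

/-- **Serre's dimension count for the tower**: `h⁰(𝔙, 𝒪(L_{m+2})) > 0` for some `m`.
[cite: SerreGAGA1956, n°16 Lemme 8 (dimension count)] -/
theorem exists_finrank_cohomology_zero_pos
    (hdense : Dense {x : M | ∀ a : H.ι, (φ x).pt ∈ H.U a → H.sectionCoord φ hs₀ a x ≠ 0})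
    (hd : ∀ (a : H.ι) (x : M), (φ x).pt ∈ H.U a → H.sectionCoord φ hs₀ a x = 0 →
      mfderiv 𝓘(ℂ, E) 𝓘(ℂ, ℂ) (H.sectionCoord φ hs₀ a) x ≠ 0)
    (htr : ∀ (a : H.ι) (x : M), (φ x).pt ∈ H.U a → H.sectionCoord φ hs₀ a x = 0 →
      H.sectionCoord φ hs₁ a x = 0 → ∀ c : ℂ,
        mfderiv 𝓘(ℂ, E) 𝓘(ℂ, ℂ) (H.sectionCoord φ hs₁ a) x ≠ c • mfderiv 𝓘(ℂ, E) 𝓘(ℂ, ℂ) (H.sectionCoord φ hs₀ a) x)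
    (hDv : ∀ (a : ℕ) (J : Fin (a + 1) → ↥D.s) (b : holFunOn E (cechSet (D.U 0) J)),
      (∀ x ∈ zset (φ := φ) H hs₀ hs₁ ∩ cechSet (D.U 0) J, (b : M → ℂ) x = 0) →
        ∃ b₀ b₁ : holFunOn E (cechSet (D.U 0) J), ∀ x ∈ cechSet (D.U 0) J,
          (b : M → ℂ) x = H.sectionCoord φ hs₀ (fr (J 0)).2 x * (b₀ : M → ℂ) x +
            H.sectionCoord φ hs₁ (fr (J 0)).2 x * (b₁ : M → ℂ) x)
    (hZ : (zset (φ := φ) H hs₀ hs₁).Finite) (hZne : (zset (φ := φ) H hs₀ hs₁).Nonempty) :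
    ∃ m, 0 < Module.finrank ℂ (NatCochain.Cohomology (R := ℂ) (fun a ↦ (cov hφ H L D fr hfr (m + 2)).delta a) 0) := by
  refine exists_pos_h0_of_euler_inequalities 2 (hnum hφ H L hs₀ hs₁ D fr hfr 0) (hnum hφ H L hs₀ hs₁ D fr hfr 1)
    (fun j hj m ↦ ?_) (fun m ↦ finrank_cohS_one_lt hφ H L hs₀ hs₁ D fr hfr hZ hZne (m + 2))
  interval_cases j
  · -- `0 → F₁(m) → F₁(m+1) → F₀(m+1) → 0`
    haveI := fun k q ↦ finiteDimensional_cohQ hφ H L hs₀ D fr hfr hdense k q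
    haveI := fun k q ↦ finiteDimensional_cohS hφ H L hs₀ hs₁ D fr hfr hZ k q
    exact (sesQ hφ H L hs₀ hs₁ D fr hfr hd htr hDv hZ (m + 1)).finrank_six_term_le
  · -- `0 → C•(L_{m+2}) → C•(L_{m+3}) → F₁(m+1) → 0`
    haveI := fun k q ↦ finiteDimensional_cohQ hφ H L hs₀ D fr hfr hdense k q
    haveI := fun k q ↦ finiteDimensional_cohC hφ H L D fr hfr k q
    exact (sesC hφ H L hs₀ D fr hfr hdense (m + 2)).finrank_six_term_le

include hfr in
/-- **A non-zero holomorphic section of some `L_{m+2}`** (`dim H⁰ > 0`, `FramedCover.finrank_cohomology_zero`,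
`exists_zeroSet_ne_univ_of_h0_pos`). [cite: SerreGAGA1956, n°16 Lemme 8] -/
theorem exists_globalSection
    (hdense : Dense {x : M | ∀ a : H.ι, (φ x).pt ∈ H.U a → H.sectionCoord φ hs₀ a x ≠ 0})
    (hd : ∀ (a : H.ι) (x : M), (φ x).pt ∈ H.U a → H.sectionCoord φ hs₀ a x = 0 →
      mfderiv 𝓘(ℂ, E) 𝓘(ℂ, ℂ) (H.sectionCoord φ hs₀ a) x ≠ 0)
    (htr : ∀ (a : H.ι) (x : M), (φ x).pt ∈ H.U a → H.sectionCoord φ hs₀ a x = 0 →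
      H.sectionCoord φ hs₁ a x = 0 → ∀ c : ℂ,
        mfderiv 𝓘(ℂ, E) 𝓘(ℂ, ℂ) (H.sectionCoord φ hs₁ a) x ≠ c • mfderiv 𝓘(ℂ, E) 𝓘(ℂ, ℂ) (H.sectionCoord φ hs₀ a) x)
    (hDv : ∀ (a : ℕ) (J : Fin (a + 1) → ↥D.s) (b : holFunOn E (cechSet (D.U 0) J)),
      (∀ x ∈ zset (φ := φ) H hs₀ hs₁ ∩ cechSet (D.U 0) J, (b : M → ℂ) x = 0) →
        ∃ b₀ b₁ : holFunOn E (cechSet (D.U 0) J), ∀ x ∈ cechSet (D.U 0) J,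
          (b : M → ℂ) x = H.sectionCoord φ hs₀ (fr (J 0)).2 x * (b₀ : M → ℂ) x +
            H.sectionCoord φ hs₁ (fr (J 0)).2 x * (b₁ : M → ℂ) x)
    (hZ : (zset (φ := φ) H hs₀ hs₁).Finite) (hZne : (zset (φ := φ) H hs₀ hs₁).Nonempty) :
    ∃ (m : ℕ) (σ : (twistBundle hφ H L (m + 2)).GlobalSection), σ.zeroSet ≠ univ := by
  obtain ⟨m, hm⟩ := exists_finrank_cohomology_zero_pos hφ H L hs₀ hs₁ D fr hfr hdense hd htr hDv hZ hZne
  have hcov : ∀ x : M, ∃ k, x ∈ (cov hφ H L D fr hfr (m + 2)).U k := fun x ↦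
    mem_iUnion.1 (show x ∈ ⋃ i, D.U 0 i by rw [D.cover 0]; exact mem_univ x)
  have h := (cov hφ H L D fr hfr (m + 2)).finrank_cohomology_zero hcov
  refine ⟨m, HolomorphicLineBundle.exists_zeroSet_ne_univ_of_h0_pos (L := twistBundle hφ H L (m + 2)) ?_⟩
  rw [← h]
  exact hm

end SerreTheoremASurface

/-! ### Assembly -/

/-- `1` stays a section of the multiples of an effective divisor: `f_i` regular ⟹ `f_i^m` regular.
[cite: GortzWedhorn2020, (11.9)] -/
theorem isSection_one_smul {X : Scheme} [IsIntegral X] {H : CartierDivisor X} (h : H.IsSection 1) (m : ℕ) :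
    (m • H).IsSection 1 := by
  intro i x hx
  have h1 := h i x hx
  rw [mul_one] at h1 ⊢
  exact h1.pow m

/-- A `Fin 1`-indexed family of linear forms is jointly onto only if the form is non-zero. [folklore] -/
theorem ne_zero_of_surjective_pi_fin_one {V : Type*} [AddCommGroup V] [Module ℂ V] [TopologicalSpace V]
    {T : Fin 1 → V →L[ℂ] ℂ} (h : Function.Surjective (ContinuousLinearMap.pi T)) : T 0 ≠ 0 := by
  intro h0
  obtain ⟨v, hv⟩ := h fun _ ↦ 1
  have h1 := congr_fun hv 0
  rw [ContinuousLinearMap.pi_apply, h0] at h1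
  exact one_ne_zero h1.symm

/-- The carrier of a Hodge model of a smooth projective scheme is compact (`X` proper, GAGA §2 n°7
Prop. 6, and the comparison map is a homeomorphism). [cite: SerreGAGA1956, §2 n°7 Prop. 6] -/
theorem compactSpace_carrier_of_isSmoothProjective' {n : ℕ} {X : SchemeOver ℂ} (A : HodgeModel n X)
    (hX : IsSmoothProjective n X) : CompactSpace A.carrier := by
  haveI : IsProper X.hom := IsSmoothProjective.isProper_holds hX
  haveI : CompactSpace (ComplexPoints X) := compactSpace_algPoints_of_isProper_holds X ℂ
  exact A.isAnalytification.homeomorph.symm.compactSpace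

/-- **Serre's théorème A for line cocycles on a smooth projective surface** (GAGA n° 16 Lemme 8 for
`𝓜 = 𝒪(L)`): for every holomorphic line bundle `L` (a cocycle) on `X^an`, `X` a smooth projective
surface, some algebraic twist `L ⊗ 𝒪_X(D)^an` (`D = (m+2)H`, `H` a general hyperplane section, with
its algebraic section `1`) has a holomorphic section which does not vanish identically — by Serre's
dimension count over two general hyperplane sections (this file). [cite: SerreGAGA1956, n°16 Lemme 8] -/
theorem serre_theoremA_lineCocycle_surface_holds :
    serre_theoremA_lineCocycle_surface := by
  intro X hX
  haveI : IsIntegral X.left := IsSmoothProjective.isIntegral_holds hX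
  intro A ι L
  haveI : CompactSpace A.carrier := compactSpace_carrier_of_isSmoothProjective' A hX
  have hφ : IsAnalytification A.model X 2 A.toComplexPoints := A.isAnalytification
  obtain ⟨H, s, hs, hs0, hflag, hZfin, hZne, hdense⟩ := exists_transverse_flag hX two_pos hφ
  -- the Leray datum of `L_0`, a framed cover of every `L_m`
  obtain ⟨D, fr, hfr, -⟩ := (twistBundle hφ H L 0).exists_dolbeaultLerayDatum_subordinate
    ⟨fun _ ↦ univ, fun _ ↦ isOpen_univ, fun _ ↦ mem_univ _⟩
  -- the hypotheses of the count
  have hd : ∀ (a : H.ι) (x : A.carrier), (A.toComplexPoints x).pt ∈ H.U a →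
      H.sectionCoord A.toComplexPoints (hs 0) a x = 0 →
        mfderiv 𝓘(ℂ, A.model) 𝓘(ℂ, ℂ) (H.sectionCoord A.toComplexPoints (hs 0) a) x ≠ 0 := by
    intro a x ha h0
    have h1 := hflag a x 1 one_le_two ha (fun i ↦ by rw [Fin.fin_one_eq_zero i]; exact h0)
    exact ne_zero_of_surjective_pi_fin_one h1
  have htr : ∀ (a : H.ι) (x : A.carrier), (A.toComplexPoints x).pt ∈ H.U a →
      H.sectionCoord A.toComplexPoints (hs 0) a x = 0 → H.sectionCoord A.toComplexPoints (hs 1) a x = 0 →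
        Function.Surjective (ContinuousLinearMap.pi
          ![mfderiv 𝓘(ℂ, A.model) 𝓘(ℂ, ℂ) (H.sectionCoord A.toComplexPoints (hs 0) a) x,
            mfderiv 𝓘(ℂ, A.model) 𝓘(ℂ, ℂ) (H.sectionCoord A.toComplexPoints (hs 1) a) x]) := by
    intro a x ha h0 h1
    have h2 := hflag a x 2 (le_refl 2) ha (fun i ↦ by
      fin_cases i
      · exact h0
      · exact h1)
    have e : (fun i : Fin 2 ↦ mfderiv 𝓘(ℂ, A.model) 𝓘(ℂ, ℂ)
        (H.sectionCoord A.toComplexPoints (hs (Fin.castLE (le_refl 2) i)) a) x) =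
        ![mfderiv 𝓘(ℂ, A.model) 𝓘(ℂ, ℂ) (H.sectionCoord A.toComplexPoints (hs 0) a) x,
          mfderiv 𝓘(ℂ, A.model) 𝓘(ℂ, ℂ) (H.sectionCoord A.toComplexPoints (hs 1) a) x] := by
      funext i; fin_cases i <;> rfl
    rwa [e] at h2
  have htr' : ∀ (a : H.ι) (x : A.carrier), (A.toComplexPoints x).pt ∈ H.U a →
      H.sectionCoord A.toComplexPoints (hs 0) a x = 0 → H.sectionCoord A.toComplexPoints (hs 1) a x = 0 →
        ∀ c : ℂ, mfderiv 𝓘(ℂ, A.model) 𝓘(ℂ, ℂ) (H.sectionCoord A.toComplexPoints (hs 1) a) x ≠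
          c • mfderiv 𝓘(ℂ, A.model) 𝓘(ℂ, ℂ) (H.sectionCoord A.toComplexPoints (hs 0) a) x :=
    fun a x ha h0 h1 c hc ↦ not_surjective_pi_of_eq_smul hc (htr a x ha h0 h1)
  have hZeq : SerreTheoremASurface.zset (φ := A.toComplexPoints) H (hs 0) (hs 1) =
      {m | ∃ a : H.ι, (A.toComplexPoints m).pt ∈ H.U a ∧ ∀ j, H.sectionCoord A.toComplexPoints (hs j) a m = 0} := by
    ext x
    simp only [SerreTheoremASurface.zset, mem_setOf_eq, Fin.forall_fin_two]
  have hZ : (SerreTheoremASurface.zset (φ := A.toComplexPoints) H (hs 0) (hs 1)).Finite := by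
    rw [hZeq]; exact hZfin
  have hZne' : (SerreTheoremASurface.zset (φ := A.toComplexPoints) H (hs 0) (hs 1)).Nonempty := by
    rw [hZeq]; exact hZne
  have hDv : ∀ (a : ℕ) (J : Fin (a + 1) → ↥D.s) (b : holFunOn A.model (cechSet (D.U 0) J)),
      (∀ x ∈ SerreTheoremASurface.zset (φ := A.toComplexPoints) H (hs 0) (hs 1) ∩ cechSet (D.U 0) J, (b : A.carrier → ℂ) x = 0) →
        ∃ b₀ b₁ : holFunOn A.model (cechSet (D.U 0) J), ∀ x ∈ cechSet (D.U 0) J,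
          (b : A.carrier → ℂ) x = H.sectionCoord A.toComplexPoints (hs 0) (fr (J 0)).2 x * (b₀ : A.carrier → ℂ) x +
            H.sectionCoord A.toComplexPoints (hs 1) (fr (J 0)).2 x * (b₁ : A.carrier → ℂ) x := by
    intro a J b hb
    set p := fr (J 0)
    have hWU : cechSet (D.U 0) J ⊆ A.toComplexPoints ⁻¹' {P | P.pt ∈ H.U p.2} := fun x hx ↦
      SerreTheoremASurface.pt_mem_of_mem_cechSet hφ H L D fr hfr hx
    have ht₀ := ((mdifferentiableOn_sectionCoord hφ (hs 0) p.2).mono hWU)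
    have ht₁ := ((mdifferentiableOn_sectionCoord hφ (hs 1) p.2).mono hWU)
    rw [D.cechSet_eq a J 0] at ht₀ ht₁
    obtain ⟨g₁, g₂, hg₁, hg₂, hfg⟩ := exists_mdifferentiableOn_eq_add_mul_chartSet hφ.finrank_eq (D.ctr a J)
      (D.C_open a J 0) (D.C_convex a J 0) (D.C_subset a J 0) ht₀ ht₁ (by rw [← D.cechSet_eq a J 0]; exact b.2.1)
      (fun x hx h0 ↦ hd p.2 x (hWU (by rwa [D.cechSet_eq a J 0])) h0)
      (fun x hx h0 h1 ↦ htr p.2 x (hWU (by rwa [D.cechSet_eq a J 0])) h0 h1)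
      (fun x hx h0 h1 ↦ by
        rw [← D.cechSet_eq a J 0] at hx
        exact hb x ⟨(SerreTheoremASurface.mem_zset_iff H (hs 0) (hs 1) (hWU hx)).2 ⟨h0, h1⟩, hx⟩)
    rw [← D.cechSet_eq a J 0] at hg₁ hg₂ hfg
    exact ⟨SerreTheoremASurface.holCut g₁ hg₁, SerreTheoremASurface.holCut g₂ hg₂, fun x hx ↦ by
      rw [SerreTheoremASurface.holCut_apply_of_mem g₁ hg₁ hx, SerreTheoremASurface.holCut_apply_of_mem g₂ hg₂ hx]
      exact hfg x hx⟩
  obtain ⟨m, σ, hσ⟩ := SerreTheoremASurface.exists_globalSection hφ H L (hs 0) (hs 1) D fr hfr (hdense 0) hd htr'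
    hDv hZ hZne'
  have h1 : H.IsSection 1 := hs0 ▸ hs ⟨0, two_pos⟩
  exact ⟨(m + 2) • H, 1, isSection_one_smul h1 (m + 2), one_ne_zero, σ, hσ⟩


end Literature.AlgebraicGeometry.HodgeTheory

end
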